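import Literature.Analysis.FluidPDE.HarmonicProbe
import HarnessLib

/-!
# Differentiation under the integral sign on the kernel side: `x ↦ ∫ k(x − y) • g(y) dy`

Analysis/FluidPDE support file (everything proved, no definitions) on the discharge path of the
named fact `Literature.Analysis.FluidPDE.MajdaBertozzi2002_holderEulerLocalExistence`
(`ElgindiBlowupContinuationProofs.lean`; Lagrangian decomposition `HolderEulerLagrangian.lean`),
where the first derivatives of the Newtonian potential of a merely Hölder continuous density
`f` are obtained as limits of the regularised potentials `∫ k_ε(x − y) • f(y) dy` with `C¹`
compactly supported kernels `k_ε` (Gilbarg–Trudinger 2001, proof of Lemma 4.2 with the cutoff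
`η`, and Lemma 4.4). The tree's `HarmonicProbe.lean` differentiates such integrals when the
**density** is smooth (`hasFDerivAt_integral_smul_comp_sub`: `x ↦ ∫ k(z) • g(x − z) dz`,
`g ∈ C¹`); here the derivative falls on the **kernel** and the density is only continuous:

* `exists_radius_bounds_of_contDiff_hasCompactSupport`: a `C¹` compactly supported kernel has
  a support radius `R ≥ 0` and a bounded derivative;
* `hasFDerivAt_integral_kernel_sub_smul`: for `k ∈ C¹_c(ℝ³; ℝ)` and continuous `g : ℝ³ → F`,
  `x ↦ ∫ k(x − y) • g(y) dy` has derivative `∫ Dk(x₀ − y)(·) • g(y) dy` at `x₀` (dominated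
  convergence on `B(x₀, 1)`: the `x`-derivative of the integrand is bounded by
  `‖Dk‖_∞ sup_{B̄(x₀, R+1)} ‖g‖` on `B̄(x₀, R + 1)` and vanishes off it);
  `fderiv_integral_kernel_sub_smul_apply` is the directional form
  `∂_b ∫ k(x − y) • g(y) dy = ∫ (Dk(x − y) b) • g(y) dy`;
* `integrable_kernel_sub_smul` (integrable kernel vanishing off a ball, continuous density) and
  `integrable_kernel_sub_smul_of_continuous` (continuous compactly supported kernel through a
  bilinear map) — the integrability facts used above and by the regularisation argument.

## Mathlib / tree search

Mathlib: `hasFDerivAt_integral_of_dominated_of_fderiv_le`, `ContinuousLinearMap.integral_apply`,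
`HasCompactSupport.fderiv`, `Continuous.bounded_above_of_compact_support`,
`Continuous.integrable_of_hasCompactSupport`, `image_eq_zero_of_notMem_tsupport`,
`fderiv_of_notMem_tsupport` (all used); Mathlib's `HasCompactSupport.hasFDerivAt_convolution_right`
covers convolutions `f ⋆ g` with the smooth factor compactly supported and the other locally
integrable, through the `convolution` API with a bilinear map; the present elementary form (plain
Bochner integral of `k(x − y) • g(y)`) is the one matching the tree's potentials
(`biotSavart`, `czDiff`, `newtonNearGrad`). Tree: `HarmonicProbe.lean` (density-side versions).

## References

* D. Gilbarg, N. S. Trudinger, *Elliptic Partial Differential Equations of Second Order*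
  (2001), Lemma 4.1 and the proof of Lemma 4.2. [GilbargTrudinger2001]
-/

noncomputable section

open MeasureTheory Set Function Filter Metric Real
open _root_.Topology

namespace Literature.Analysis.FluidPDE

variable {F : Type*} [NormedAddCommGroup F] [NormedSpace ℝ F]

/-- A `C¹` kernel with compact support: a support radius `R ≥ 0` (off the closed ball of
radius `R` the kernel and its derivative vanish) and a bound `D` for the derivative. [folklore] -/
theorem exists_radius_bounds_of_contDiff_hasCompactSupport {k : (EuclideanSpace ℝ (Fin 3)) → ℝ} (hk : ContDiff ℝ 1 k)
    (hkc : HasCompactSupport k) :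
    ∃ R D : ℝ, 0 ≤ R ∧ 0 ≤ D ∧ (∀ z, R < ‖z‖ → k z = 0) ∧ (∀ z, R < ‖z‖ → fderiv ℝ k z = 0) ∧
      ∀ z, ‖fderiv ℝ k z‖ ≤ D := by
  obtain ⟨R, hR⟩ := hkc.isCompact.isBounded.subset_closedBall (0 : (EuclideanSpace ℝ (Fin 3)))
  obtain ⟨D, hD⟩ := (hk.continuous_fderiv one_ne_zero).bounded_above_of_compact_support
    (hkc.fderiv (𝕜 := ℝ))
  have hk0 : ∀ z : (EuclideanSpace ℝ (Fin 3)), max R 0 < ‖z‖ → z ∉ tsupport k := fun z hz hmem => by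
    have := mem_closedBall_zero_iff.1 (hR hmem)
    have := le_max_left R 0
    linarith
  refine ⟨max R 0, max D 0, le_max_right _ _, le_max_right _ _,
    fun z hz => image_eq_zero_of_notMem_tsupport (hk0 z hz),
    fun z hz => fderiv_of_notMem_tsupport ℝ (hk0 z hz), fun z => (hD z).trans (le_max_left _ _)⟩

/-- **Differentiation under the integral sign, kernel side**: for a `C¹` compactly supported
real kernel `k` and a continuous `g`, `x ↦ ∫ k(x − y) • g(y) dy` has derivative
`∫ Dk(x₀ − y)(·) • g(y) dy` at `x₀` (dominated convergence: for `x ∈ B(x₀, 1)` the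
`x`-derivative of the integrand is bounded by `‖Dk‖_∞ sup_{B̄(x₀,R+1)} ‖g‖` on `B̄(x₀, R + 1)` and
vanishes off it). [folklore] -/
theorem hasFDerivAt_integral_kernel_sub_smul {k : (EuclideanSpace ℝ (Fin 3)) → ℝ} (hk : ContDiff ℝ 1 k)
    (hkc : HasCompactSupport k) {g : (EuclideanSpace ℝ (Fin 3)) → F} (hg : Continuous g) (x₀ : (EuclideanSpace ℝ (Fin 3))) :
    HasFDerivAt (fun x => ∫ y, k (x - y) • g y)
      (∫ y, (fderiv ℝ k (x₀ - y)).smulRight (g y)) x₀ := by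
  obtain ⟨R, D, hR0, hD0, hkR, hDkR, hD⟩ :=
    exists_radius_bounds_of_contDiff_hasCompactSupport hk hkc
  have hkcont : Continuous k := hk.continuous
  have hDk : Continuous (fderiv ℝ k) := hk.continuous_fderiv one_ne_zero
  -- `g` is bounded on the closed ball `B̄(x₀, R + 1)`
  obtain ⟨M, hM⟩ := (isCompact_closedBall x₀ (R + 1)).exists_bound_of_continuousOn hg.continuousOn
  have hM0 : 0 ≤ M := (norm_nonneg _).trans (hM x₀ (mem_closedBall_self (by linarith)))
  -- off that ball the integrand and its `x`-derivative vanish for `x ∈ B(x₀, 1)`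
  have hfar : ∀ x ∈ ball x₀ 1, ∀ y, y ∉ closedBall x₀ (R + 1) → R < ‖x - y‖ := by
    intro x hx y hy
    rw [mem_ball, dist_eq_norm] at hx
    rw [mem_closedBall, dist_eq_norm, not_le] at hy
    have := norm_sub_le_norm_sub_add_norm_sub y x x₀
    rw [norm_sub_rev y x] at this
    linarith
  refine hasFDerivAt_integral_of_dominated_of_fderiv_le
    (F' := fun x y => (fderiv ℝ k (x - y)).smulRight (g y))
    (bound := (closedBall x₀ (R + 1)).indicator fun _ => D * M) (ball_mem_nhds x₀ zero_lt_one)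
    ?_ ?_ ?_ ?_ ?_ ?_
  · exact Eventually.of_forall fun x =>
      ((hkcont.comp (continuous_const.sub continuous_id)).smul hg).aestronglyMeasurable
  · -- the integrand at `x₀` is continuous with compact support
    refine Continuous.integrable_of_hasCompactSupport
      ((hkcont.comp (continuous_const.sub continuous_id)).smul hg) ?_
    refine HasCompactSupport.of_support_subset_isCompact (isCompact_closedBall x₀ (R + 1))
      fun y hy => ?_
    by_contra hy'
    refine hy ?_
    show k (x₀ - y) • g y = 0
    rw [hkR _ (hfar x₀ (mem_ball_self zero_lt_one) y hy'), zero_smul]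
  · exact (((ContinuousLinearMap.smulRightL ℝ (EuclideanSpace ℝ (Fin 3)) F).continuous₂).comp₂
      (hDk.comp (continuous_const.sub continuous_id)) hg).aestronglyMeasurable
  · refine Eventually.of_forall fun y x hx => ?_
    by_cases hy : y ∈ closedBall x₀ (R + 1)
    · rw [indicator_of_mem hy, ContinuousLinearMap.norm_smulRight_apply]
      exact mul_le_mul (hD _) (hM y hy) (norm_nonneg _) hD0
    · rw [indicator_of_notMem hy, hDkR _ (hfar x hx y hy)]
      have h0 : (0 : (EuclideanSpace ℝ (Fin 3)) →L[ℝ] ℝ).smulRight (g y) = 0 := by ext v; simp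
      rw [h0, norm_zero]
  · exact (integrableOn_const (measure_closedBall_lt_top (x := x₀) (r := R + 1)).ne).integrable_indicator
      measurableSet_closedBall
  · refine Eventually.of_forall fun y x _ => ?_
    have h1 : HasFDerivAt (fun x : (EuclideanSpace ℝ (Fin 3)) => k (x - y)) (fderiv ℝ k (x - y)) x := by
      have := ((hk.differentiable one_ne_zero) (x - y)).hasFDerivAt.comp x (hasFDerivAt_sub_const y)
      rwa [ContinuousLinearMap.comp_id] at this
    exact h1.smul_const (g y)

/-- Integrability of `y ↦ k(x − y) • g(y)` for an integrable kernel vanishing off a ball and a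
continuous `g` (which is bounded on the relevant ball about `x`). [folklore] -/
theorem integrable_kernel_sub_smul {k : (EuclideanSpace ℝ (Fin 3)) → ℝ} (hk : Integrable k) {R : ℝ}
    (hkR : ∀ z, R < ‖z‖ → k z = 0) {g : (EuclideanSpace ℝ (Fin 3)) → F} (hg : Continuous g) (x : (EuclideanSpace ℝ (Fin 3))) :
    Integrable fun y => k (x - y) • g y := by
  obtain ⟨M, hM⟩ := (isCompact_closedBall x R).exists_bound_of_continuousOn hg.continuousOn
  refine Integrable.mono' ((hk.comp_sub_left x).norm.mul_const M)
    ((hk.aestronglyMeasurable.comp_quasiMeasurePreserving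
      (quasiMeasurePreserving_sub_left volume x)).smul hg.aestronglyMeasurable)
    (Eventually.of_forall fun y => ?_)
  by_cases hy : y ∈ closedBall x R
  · rw [norm_smul]
    exact mul_le_mul_of_nonneg_left (hM y hy) (norm_nonneg _)
  · rw [mem_closedBall, dist_eq_norm, norm_sub_rev, not_le] at hy
    rw [hkR _ hy, zero_smul, norm_zero, norm_zero, zero_mul]

/-- A continuous compactly supported kernel against a continuous `g`: `y ↦ k(x − y) • g(y)` is
continuous with compact support, hence integrable. [folklore] -/
theorem integrable_kernel_sub_smul_of_continuous {W : Type*} [NormedAddCommGroup W]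
    [NormedSpace ℝ W] {k : (EuclideanSpace ℝ (Fin 3)) → W} (hk : Continuous k) (hkc : HasCompactSupport k)
    {V : Type*} [NormedAddCommGroup V] [NormedSpace ℝ V] (B : W →L[ℝ] F →L[ℝ] V)
    {g : (EuclideanSpace ℝ (Fin 3)) → F} (hg : Continuous g) (x : (EuclideanSpace ℝ (Fin 3))) :
    Integrable fun y => B (k (x - y)) (g y) := by
  obtain ⟨R, hR⟩ := hkc.isCompact.isBounded.subset_closedBall (0 : (EuclideanSpace ℝ (Fin 3)))
  refine Continuous.integrable_of_hasCompactSupport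
    (B.continuous₂.comp₂ (hk.comp (continuous_const.sub continuous_id)) hg) ?_
  refine HasCompactSupport.of_support_subset_isCompact (isCompact_closedBall x R) fun y hy => ?_
  by_contra hy'
  refine hy ?_
  have hk0 : k (x - y) = 0 := by
    refine image_eq_zero_of_notMem_tsupport fun hmem => hy' ?_
    have := mem_closedBall_zero_iff.1 (hR hmem)
    rwa [mem_closedBall, dist_eq_norm, norm_sub_rev]
  show B (k (x - y)) (g y) = 0
  rw [hk0, map_zero, zero_apply]

/-- The directional form of `hasFDerivAt_integral_kernel_sub_smul`:
`∂_b ∫ k(x − y) • g(y) dy = ∫ (Dk(x − y) b) • g(y) dy`. [folklore] -/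
theorem fderiv_integral_kernel_sub_smul_apply [CompleteSpace F] {k : (EuclideanSpace ℝ (Fin 3)) → ℝ}
    (hk : ContDiff ℝ 1 k) (hkc : HasCompactSupport k) {g : (EuclideanSpace ℝ (Fin 3)) → F} (hg : Continuous g)
    (x b : (EuclideanSpace ℝ (Fin 3))) :
    fderiv ℝ (fun x => ∫ y, k (x - y) • g y) x b = ∫ y, (fderiv ℝ k (x - y) b) • g y := by
  rw [(hasFDerivAt_integral_kernel_sub_smul hk hkc hg x).fderiv,
    ContinuousLinearMap.integral_apply]
  · rfl
  · exact integrable_kernel_sub_smul_of_continuous (hk.continuous_fderiv one_ne_zero)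
      (hkc.fderiv (𝕜 := ℝ)) (ContinuousLinearMap.smulRightL ℝ (EuclideanSpace ℝ (Fin 3)) F) hg x

end Literature.Analysis.FluidPDE
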